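import Summits.QuantumFields.YangMills.Theorems.EquipartitionCriticalityEquipartitionPinsProbeKernelFixesExact
import Literature.Probability.LatticeModels.ThermodynamicLimit
import HarnessLib

/-!
# Crux U `FreeProbeLawG` (stmt-QuantumFields-23756), line `birth`, stub `stub_blockGreen` — part 1: box truncation of a `1`-cochain

Route `SteinGapBootstrap` of `QuantumFields/YangMills` (lead `ym-line-sgb-k1-g1`; width seat `ym-line-sgb-p2-g2`). HONEST
LABEL: the route serves the RECORD-label rung R2ξ-G (`WeakCouplingRates.XiPow`, an UPPER bound on the lattice gap); nothing
here bears on the Yang–Mills mass gap itself. Pure lattice bookkeeping on `ℤ⁴`, no gauge theory.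

Generic half of the registered stub `stub_blockGreen` (file `…FreeProbeLawGStubBlockGreen.lean`): for a plaquette `p`,
a radius `R : ℕ`, a `1`-cochain `ω∞` on the edges of `ℤ⁴` with `dω∞ = curvatureTwoPoint p ·` and a `1`-cochain `ω`
that agrees with `ω∞` on the edges based in the box `[-R, R]⁴` and vanishes (or at least is dominated by `ω∞`) elsewhere,
we prove the four clauses of the stub in terms of two numbers: a uniform bound `K ≥ |ω∞|` and a far-field bound
`M ≥ |ω∞(e)|` on edges `e` with a coordinate `|e.1 n| ≥ R`:
* `sum_abs_le_of_support` (b): `∑_{e ∈ T} |ω e| ≤ 64 K (1+R)⁴` (there are `4(2R+1)⁴` edges based in the box);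
* `plaquetteCurl_eq_of_inner` (c): `(dω)_q = (dω∞)_q` when `2|q.1 k| + 2 ≤ R` (the four edges of `q` are in the box);
* `sum_curl_mul_eq`: `∑_{q ∈ T} (dω)_q · curvatureTwoPoint p q = curvatureTwoPoint p p` for every finite
  `T ⊇ supp dω` — the curvature kernel reproduces finitely supported exact `2`-cochains (`d^*(dΓd^*) = d^*`, tree
  `EquipartitionPinsProbe.stub_kernelFixesExact`: the `1`-form Hodge identity and the Poisson equation of `latticeGreen`);
* `abs_sum_sq_sub_le` (d): hence `∑_T (dω)_q² − curvatureTwoPoint p p = ∑_T (dω)_q (d(ω − ω∞))_q`, a sum over the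
  `≤ 16(2R+3)⁴` plaquettes touching the box whose summand vanishes unless `q` has an edge outside the box, in which case all
  four edges of `q` are far (`|e.1 n| ≥ R`) and the summand is `≤ 16 M²`; total `≤ 16(2R+3)⁴ · 16M²`.
Part 2 instantiates `ω∞ = Γ d^* δ_p` (`K` from Lawler's gradient bound, `M = 8K'(1+R)^(−3)`).

References: G. Lawler, *Intersections of random walks* (1991), §1.5 [Lawler1991]; C. Garban, A. Sepúlveda, IMRN 2023,
§§3.3–4 (`dΓd^*` on `2`-forms) [GarbanSepulveda2023].
-/

set_option autoImplicit false

noncomputable section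

open Literature.MathematicalPhysics.QuantumLattice Literature.MathematicalPhysics.QuantumFieldTheory
open Literature.Probability.LatticeModels
open Summit.QuantumFields.YangMills.Theorems.EquipartitionPinsProbe

namespace Summit.QuantumFields.YangMills.Cruxes.FreeProbeLawG.SteinFree.BlockGreen

/-! ### Curl bookkeeping -/

/-- Linearity of the curl: `d(A − B) = dA − dB`. -/
theorem plaquetteCurl_sub (A B : ZdEdge 4 → ℝ) (q : ZdPlaquette 4) :
    plaquetteCurl (fun e => A e - B e) q = plaquetteCurl A q - plaquetteCurl B q := by
  simp only [plaquetteCurl, mul_sub, Finset.sum_sub_distrib]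

/-- `|(dA)_q| ≤ 4M` when `|A| ≤ M` on the four boundary edges of `q`. -/
theorem abs_plaquetteCurl_le {A : ZdEdge 4 → ℝ} {q : ZdPlaquette 4} {M : ℝ}
    (h : ∀ a : Fin 4, |A (plaquetteBoundary q a)| ≤ M) : |plaquetteCurl A q| ≤ 4 * M := by
  unfold plaquetteCurl
  calc |∑ a : Fin 4, plaquetteBoundarySign a * A (plaquetteBoundary q a)|
      ≤ ∑ a : Fin 4, |plaquetteBoundarySign a * A (plaquetteBoundary q a)| :=
        Finset.abs_sum_le_sum_abs _ _
    _ ≤ ∑ _a : Fin 4, M := Finset.sum_le_sum fun a _ => by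
        have hσ : |plaquetteBoundarySign a| = 1 := by
          fin_cases a <;> simp [plaquetteBoundarySign]
        rw [abs_mul, hσ, one_mul]
        exact h a
    _ = 4 * M := by simp

/-- If `(dA)_q ≠ 0` then `A` is nonzero on some boundary edge of `q`. -/
theorem exists_ne_zero_of_plaquetteCurl_ne_zero {A : ZdEdge 4 → ℝ} {q : ZdPlaquette 4}
    (h : plaquetteCurl A q ≠ 0) : ∃ a : Fin 4, A (plaquetteBoundary q a) ≠ 0 := by
  by_contra hA
  push Not at hA
  exact h (by simp [plaquetteCurl, hA])

/-- The base points of the four boundary edges of `q` lie in `q.1 + {0,1}⁴` coordinatewise. -/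
theorem fst_le_boundary_fst (q : ZdPlaquette 4) (a n : Fin 4) :
    q.1 n ≤ (plaquetteBoundary q a).1 n ∧ (plaquetteBoundary q a).1 n ≤ q.1 n + 1 := by
  have h1 : ∀ i : Fin 4, q.1 n ≤ (q.1 + Pi.single i 1 : Site 4) n ∧
      (q.1 + Pi.single i 1 : Site 4) n ≤ q.1 n + 1 := by
    intro i
    have : (q.1 + Pi.single i 1 : Site 4) n = q.1 n + if n = i then 1 else 0 := by
      simp [Pi.single_apply]
    rw [this]
    split_ifs <;> constructor <;> linarith
  fin_cases a
  · simp [plaquetteBoundary]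
  · exact h1 _
  · exact h1 _
  · simp [plaquetteBoundary]

/-- The boundary edges of a plaquette `q` with `2|q.1 k| + 2 ≤ R` are based in the box `[-R, R]⁴`. -/
theorem abs_boundary_fst_le {q : ZdPlaquette 4} {R : ℕ} (hq : ∀ k : Fin 4, 2 * |q.1 k| + 2 ≤ (R : ℤ))
    (a k : Fin 4) : |(plaquetteBoundary q a).1 k| ≤ (R : ℤ) := by
  obtain ⟨h1, h2⟩ := fst_le_boundary_fst q a k
  have hk := hq k
  have h3 := le_abs_self (q.1 k)
  have h4 := neg_abs_le (q.1 k)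
  have h5 := abs_nonneg (q.1 k)
  rw [abs_le]
  constructor <;> linarith

/-- If one boundary edge of `q` has a coordinate of absolute value `> R`, every boundary edge of `q` has that
coordinate of absolute value `≥ R`. -/
theorem le_abs_boundary_of_lt {q : ZdPlaquette 4} {a : Fin 4} {n : Fin 4} {R : ℕ}
    (h : (R : ℤ) < |(plaquetteBoundary q a).1 n|) (b : Fin 4) :
    (R : ℤ) ≤ |(plaquetteBoundary q b).1 n| := by
  obtain ⟨ha1, ha2⟩ := fst_le_boundary_fst q a n
  obtain ⟨hb1, hb2⟩ := fst_le_boundary_fst q b n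
  rcases le_or_gt 0 ((plaquetteBoundary q a).1 n) with hu | hu
  · rw [abs_of_nonneg hu] at h
    exact le_trans (by linarith) (le_abs_self _)
  · rw [abs_of_neg hu] at h
    exact le_trans (by linarith) (neg_le_abs _)

/-! ### Boxes of edges and plaquettes -/

/-- A `1`-cochain supported on edges based in `[-R, R]⁴` is supported in the finite set `box 4 R ×ˢ univ`. -/
theorem mem_box_edges_of_ne_zero {ω : ZdEdge 4 → ℝ} {R : ℕ}
    (hsupp : ∀ e, ω e ≠ 0 → ∀ k : Fin 4, |e.1 k| ≤ (R : ℤ)) {e : ZdEdge 4} (h : ω e ≠ 0) :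
    e ∈ box 4 R ×ˢ (Finset.univ : Finset (Fin 4)) :=
  Finset.mem_product.2 ⟨mem_box.2 fun k => abs_le.1 (hsupp e h k), Finset.mem_univ _⟩

/-- … and its curl is supported on plaquettes based in `[-(R+1), R+1]⁴`. -/
theorem mem_box_plaquettes_of_ne_zero {ω : ZdEdge 4 → ℝ} {R : ℕ}
    (hsupp : ∀ e, ω e ≠ 0 → ∀ k : Fin 4, |e.1 k| ≤ (R : ℤ)) {q : ZdPlaquette 4} (h : plaquetteCurl ω q ≠ 0) :
    q ∈ box 4 (R + 1) ×ˢ (Finset.univ : Finset {ij : Fin 4 × Fin 4 // ij.1 < ij.2}) := by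
  obtain ⟨a, ha⟩ := exists_ne_zero_of_plaquetteCurl_ne_zero h
  have hk := hsupp _ ha
  refine Finset.mem_product.2 ⟨mem_box.2 fun k => ?_, Finset.mem_univ _⟩
  obtain ⟨h1, h2⟩ := fst_le_boundary_fst q a k
  have h3 := abs_le.1 (hk k)
  push_cast
  constructor <;> linarith [h3.1, h3.2]

/-- `|box 4 R ×ˢ univ| = 4(2R+1)⁴` edges. -/
theorem card_box_edges (R : ℕ) : (box 4 R ×ˢ (Finset.univ : Finset (Fin 4))).card = (2 * R + 1) ^ 4 * 4 := by
  rw [Finset.card_product, card_box, Finset.card_univ, Fintype.card_fin]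

/-- `|box 4 (R+1) ×ˢ univ| ≤ 16(2R+3)⁴` plaquettes. -/
theorem card_box_plaquettes_le (R : ℕ) :
    ((box 4 (R + 1) ×ˢ (Finset.univ : Finset {ij : Fin 4 × Fin 4 // ij.1 < ij.2})).card : ℝ) ≤
      16 * (2 * (R : ℝ) + 3) ^ 4 := by
  have h : (box 4 (R + 1) ×ˢ (Finset.univ : Finset {ij : Fin 4 × Fin 4 // ij.1 < ij.2})).card ≤
      (2 * (R + 1) + 1) ^ 4 * 16 := by
    rw [Finset.card_product, card_box, Finset.card_univ]
    refine Nat.mul_le_mul_left _ ?_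
    calc Fintype.card {ij : Fin 4 × Fin 4 // ij.1 < ij.2} ≤ Fintype.card (Fin 4 × Fin 4) :=
          Fintype.card_subtype_le _
      _ = 16 := by simp
  have h' : ((box 4 (R + 1) ×ˢ (Finset.univ : Finset {ij : Fin 4 × Fin 4 // ij.1 < ij.2})).card : ℝ) ≤
      (((2 * (R + 1) + 1) ^ 4 * 16 : ℕ) : ℝ) := by exact_mod_cast h
  refine h'.trans (le_of_eq ?_)
  push_cast
  ring

/-! ### (b) the `ℓ¹` bound of a box-supported cochain -/

/-- (b): a `1`-cochain supported on edges based in `[-R, R]⁴` and bounded by `K ≥ 0` has `∑_{e ∈ T} |ω e| ≤ 64K(1+R)⁴`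
along every finite edge set `T`. -/
theorem sum_abs_le_of_support {ω : ZdEdge 4 → ℝ} {R : ℕ} {K : ℝ}
    (hsupp : ∀ e, ω e ≠ 0 → ∀ k : Fin 4, |e.1 k| ≤ (R : ℤ)) (hK0 : 0 ≤ K) (hK : ∀ e, |ω e| ≤ K)
    (T : Finset (ZdEdge 4)) : ∑ e ∈ T, |ω e| ≤ 64 * K * (1 + (R : ℝ)) ^ 4 := by
  set E : Finset (ZdEdge 4) := box 4 R ×ˢ (Finset.univ : Finset (Fin 4)) with hE
  have h1 : ∑ e ∈ T ∩ E, |ω e| = ∑ e ∈ T, |ω e| := by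
    refine Finset.sum_subset Finset.inter_subset_left fun e heT he => ?_
    rw [abs_eq_zero]
    by_contra hne
    exact he (Finset.mem_inter.2 ⟨heT, mem_box_edges_of_ne_zero hsupp hne⟩)
  rw [← h1]
  calc ∑ e ∈ T ∩ E, |ω e|
      ≤ ∑ e ∈ E, |ω e| :=
        Finset.sum_le_sum_of_subset_of_nonneg Finset.inter_subset_right fun e _ _ => abs_nonneg _
    _ ≤ E.card • K := Finset.sum_le_card_nsmul _ _ _ fun e _ => hK e
    _ = ((2 * R + 1) ^ 4 * 4 : ℕ) * K := by rw [hE, card_box_edges, nsmul_eq_mul]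
    _ ≤ 64 * K * (1 + (R : ℝ)) ^ 4 := by
        push_cast
        have hR : (0 : ℝ) ≤ R := Nat.cast_nonneg R
        have h2 : (2 * (R : ℝ) + 1) ^ 4 ≤ (2 * (1 + (R : ℝ))) ^ 4 :=
          pow_le_pow_left₀ (by positivity) (by linarith) 4
        nlinarith [h2, pow_nonneg (show (0:ℝ) ≤ 1 + R by positivity) 4]

/-! ### (c) agreement of the curls inside the box -/

/-- (c): if `ω = ω∞` on edges based in `[-R, R]⁴`, then `(dω)_q = (dω∞)_q` on plaquettes `q` with `2|q.1 k| + 2 ≤ R`. -/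
theorem plaquetteCurl_eq_of_inner {ω ω' : ZdEdge 4 → ℝ} {R : ℕ}
    (heq : ∀ e : ZdEdge 4, (∀ k : Fin 4, |e.1 k| ≤ (R : ℤ)) → ω e = ω' e)
    {q : ZdPlaquette 4} (hq : ∀ k : Fin 4, 2 * |q.1 k| + 2 ≤ (R : ℤ)) :
    plaquetteCurl ω q = plaquetteCurl ω' q := by
  unfold plaquetteCurl
  refine Finset.sum_congr rfl fun a _ => ?_
  rw [heq _ (abs_boundary_fst_le hq a)]

/-! ### (d) the energy of the truncated cochain -/

/-- The reproduction step: if `ω` is supported on edges based in a box and `(dω)_p = curvatureTwoPoint p p`, then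
`∑_{q ∈ T} (dω)_q · curvatureTwoPoint p q = curvatureTwoPoint p p` for every finite `T ⊇ supp dω`
(`d^*(dΓd^*) = d^*`, tree `stub_kernelFixesExact`). -/
theorem sum_curl_mul_eq {ω : ZdEdge 4 → ℝ} {R : ℕ} {p : ZdPlaquette 4}
    (hsupp : ∀ e, ω e ≠ 0 → ∀ k : Fin 4, |e.1 k| ≤ (R : ℤ)) (hωp : plaquetteCurl ω p = curvatureTwoPoint p p)
    (T : Finset (ZdPlaquette 4)) (hT : ∀ q, plaquetteCurl ω q ≠ 0 → q ∈ T) :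
    ∑ q ∈ T, plaquetteCurl ω q * curvatureTwoPoint p q = curvatureTwoPoint p p := by
  have h := stub_kernelFixesExact T (box 4 R ×ˢ (Finset.univ : Finset (Fin 4))) ω
    (fun e he => by by_contra hne; exact he (mem_box_edges_of_ne_zero hsupp hne))
    (fun q hq => by by_contra hne; exact hq (hT q hne)) p
  rw [hωp] at h
  rw [← h]
  refine Finset.sum_congr rfl fun q _ => ?_
  rw [curvatureTwoPoint_comm]

/-- The pointwise step: if `|ω| ≤ |ω∞|`, `|ω − ω∞| ≤ |ω∞|`, `ω = ω∞` on edges based in `[-R, R]⁴`, and `|ω∞(e)| ≤ M` on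
every edge with a coordinate `|e.1 n| ≥ R`, then `|(dω)_q · ((dω)_q − (dω∞)_q)| ≤ 16 M²` for every plaquette `q`. -/
theorem abs_summand_le {ω ω' : ZdEdge 4 → ℝ} {R : ℕ} {M : ℝ} (hM0 : 0 ≤ M)
    (hle : ∀ e, |ω e| ≤ |ω' e|) (hsub : ∀ e, |ω e - ω' e| ≤ |ω' e|)
    (heq : ∀ e : ZdEdge 4, (∀ k : Fin 4, |e.1 k| ≤ (R : ℤ)) → ω e = ω' e)
    (hdecay : ∀ (e : ZdEdge 4) (n : Fin 4), (R : ℤ) ≤ |e.1 n| → |ω' e| ≤ M) (q : ZdPlaquette 4) :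
    |plaquetteCurl ω q * (plaquetteCurl ω q - plaquetteCurl ω' q)| ≤ 16 * M ^ 2 := by
  rw [← plaquetteCurl_sub]
  by_cases h0 : plaquetteCurl (fun e => ω e - ω' e) q = 0
  · rw [h0, mul_zero, abs_zero]; positivity
  obtain ⟨a, ha⟩ := exists_ne_zero_of_plaquetteCurl_ne_zero h0
  have hout : ¬ ∀ k : Fin 4, |(plaquetteBoundary q a).1 k| ≤ (R : ℤ) := by
    intro hk
    exact ha (by rw [heq _ hk, sub_self])
  push Not at hout
  obtain ⟨n, hn⟩ := hout
  have hω : ∀ b : Fin 4, |ω' (plaquetteBoundary q b)| ≤ M := fun b =>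
    hdecay _ n (le_abs_boundary_of_lt hn b)
  have h1 : |plaquetteCurl ω q| ≤ 4 * M :=
    abs_plaquetteCurl_le fun b => (hle _).trans (hω b)
  have h2 : |plaquetteCurl (fun e => ω e - ω' e) q| ≤ 4 * M :=
    abs_plaquetteCurl_le fun b => (hsub _).trans (hω b)
  rw [abs_mul]
  calc |plaquetteCurl ω q| * |plaquetteCurl (fun e => ω e - ω' e) q|
      ≤ (4 * M) * (4 * M) := mul_le_mul h1 h2 (abs_nonneg _) (by positivity)
    _ = 16 * M ^ 2 := by ring

/-- (d): under the hypotheses of `sum_curl_mul_eq` and `abs_summand_le`, with `dω∞ = curvatureTwoPoint p ·` and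
`2|p.1 k| + 2 ≤ R`, `|∑_{q ∈ T} (dω)_q² − curvatureTwoPoint p p| ≤ 16(2R+3)⁴ · 16M²` for every finite `T ⊇ supp dω`. -/
theorem abs_sum_sq_sub_le {ω ω' : ZdEdge 4 → ℝ} {R : ℕ} {M : ℝ} {p : ZdPlaquette 4} (hM0 : 0 ≤ M)
    (hsupp : ∀ e, ω e ≠ 0 → ∀ k : Fin 4, |e.1 k| ≤ (R : ℤ))
    (hle : ∀ e, |ω e| ≤ |ω' e|) (hsub : ∀ e, |ω e - ω' e| ≤ |ω' e|)
    (heq : ∀ e : ZdEdge 4, (∀ k : Fin 4, |e.1 k| ≤ (R : ℤ)) → ω e = ω' e)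
    (hcurl : ∀ q, plaquetteCurl ω' q = curvatureTwoPoint p q)
    (hp : ∀ k : Fin 4, 2 * |p.1 k| + 2 ≤ (R : ℤ))
    (hdecay : ∀ (e : ZdEdge 4) (n : Fin 4), (R : ℤ) ≤ |e.1 n| → |ω' e| ≤ M)
    (T : Finset (ZdPlaquette 4)) (hT : ∀ q, plaquetteCurl ω q ≠ 0 → q ∈ T) :
    |(∑ q ∈ T, (plaquetteCurl ω q) ^ 2) - curvatureTwoPoint p p| ≤
      16 * (2 * (R : ℝ) + 3) ^ 4 * (16 * M ^ 2) := by
  set f : ZdPlaquette 4 → ℝ := fun q => plaquetteCurl ω q * (plaquetteCurl ω q - plaquetteCurl ω' q) with hf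
  have hωp : plaquetteCurl ω p = curvatureTwoPoint p p := by
    rw [plaquetteCurl_eq_of_inner heq hp, hcurl]
  -- the reproduction identity turns the difference into a boundary sum
  have hid : (∑ q ∈ T, (plaquetteCurl ω q) ^ 2) - curvatureTwoPoint p p = ∑ q ∈ T, f q := by
    rw [← sum_curl_mul_eq hsupp hωp T hT, ← Finset.sum_sub_distrib]
    refine Finset.sum_congr rfl fun q _ => ?_
    simp only [hf, ← hcurl]
    ring
  rw [hid]
  -- localise to the plaquettes touching the box
  set B : Finset (ZdPlaquette 4) := box 4 (R + 1) ×ˢ (Finset.univ : Finset {ij : Fin 4 × Fin 4 // ij.1 < ij.2})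
    with hB
  have hloc : ∑ q ∈ T ∩ B, f q = ∑ q ∈ T, f q := by
    refine Finset.sum_subset Finset.inter_subset_left fun q hqT hq => ?_
    have h0 : plaquetteCurl ω q = 0 := by
      by_contra hne
      exact hq (Finset.mem_inter.2 ⟨hqT, mem_box_plaquettes_of_ne_zero hsupp hne⟩)
    simp [hf, h0]
  rw [← hloc]
  calc |∑ q ∈ T ∩ B, f q|
      ≤ ∑ q ∈ T ∩ B, |f q| := Finset.abs_sum_le_sum_abs _ _
    _ ≤ ∑ q ∈ B, |f q| :=
        Finset.sum_le_sum_of_subset_of_nonneg Finset.inter_subset_right fun q _ _ => abs_nonneg _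
    _ ≤ B.card • (16 * M ^ 2) :=
        Finset.sum_le_card_nsmul _ _ _ fun q _ => abs_summand_le hM0 hle hsub heq hdecay q
    _ = (B.card : ℝ) * (16 * M ^ 2) := by rw [nsmul_eq_mul]
    _ ≤ 16 * (2 * (R : ℝ) + 3) ^ 4 * (16 * M ^ 2) :=
        mul_le_mul_of_nonneg_right (card_box_plaquettes_le R) (by positivity)

end Summit.QuantumFields.YangMills.Cruxes.FreeProbeLawG.SteinFree.BlockGreen

end
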